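import Literature.Geometry.Lorentzian.KerrConvergenceProofs
import Summits.FinalStateConjecture.FinalStateConjecture.Theses.StarvedNecks

/-!
# Route StarvedNecks — crux `NecksCertify`, line `bargmann-small-late-exterior`: helpers for N2

Sorry-free lemmas that every packaging proof of the seam stub `stub_seamSurgery` (N2) needs,
independent of the (mis-stated, see the worker audit) interface `NeckAtlas`:

* §1 **Stationarity** of the Kerr–Schild data under rest-frame time shifts `x ↦ x + s ∂₀`:
  `Kerr.radius`, `Kerr.bilin` are unchanged (they depend on the spatial part only), and the
  elementary bound `‖x⃗‖ ≤ r + |a|` for the Kerr–Schild radius `r`.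
* §2 **Re-clocked motions.** Replacing the translation `c` of a motion `(Λ, c)` by
  `c + Λ(s ∂₀)` shifts the rest-frame Kerr–Schild time by `−s` and changes nothing else:
  `poincareInv`, `boostedKerrExterior`, `boostedKerrBilin`, and the `radius`/`time`/`domain`/`bilin`
  of `boostedKerrBackground` (this is how N2 arranges the clock lag S9 of `Seamed`).
* §3 **Openness of the shrunk flat domain** `{y | τ < y⁰ ∧ ∀ i, ρ'ᵢ(y⁰) < rᵢ(y)}` for continuous
  tube profiles `ρ'ᵢ` (finitely many holes).
* §4 **Clock algebra of the Lorentz group**: for `Λ ∈ O(1,3)` with `γ := (Λ∂₀)⁰` and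
  `u := Λ⁻¹∂₀`: `u⁰ = γ`, `γ² = 1 + Σₖ (uᵏ)²` (so `γ ≥ 1` when `Λ` is orthochronous),
  `(Λx)⁰ = γ x⁰ − Σₖ uᵏ xᵏ`, hence `|(Λx)⁰ − γ x⁰| ≤ √(γ² − 1) ‖x⃗‖`, and the flat-time /
  hole-time comparison `|y⁰ − c⁰ − γ t(y)| ≤ √(γ² − 1) (r(y) + |a|)` on a boosted Kerr background.

Mathlib + `Literature.Geometry.Lorentzian.{KerrSchild, KerrConvergence, KerrConvergenceProofs}`;
no definitions, no named facts.
-/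

noncomputable section

namespace Summit.FinalStateConjecture.FinalStateConjecture.Theorems.NecksCertifyBargmann.Seam

open Set Filter Topology Literature.Geometry.Lorentzian
open scoped Topology

/-! ## §1 Stationarity under `x ↦ x + s ∂₀`; `‖x⃗‖ ≤ r + |a|` -/

/-- The spatial part of `x + s ∂₀` is the spatial part of `x` (the time axis is `∂₀`). -/
theorem spatial_add_smul_basisVector_zero (s : ℝ) (x : E4) :
    E4.spatial (x + s • E4.basisVector 0) = E4.spatial x := by
  ext i
  simp [E4.spatial_apply, Fin.succ_ne_zero]

/-- The Kerr–Schild radius is invariant under time translations `x ↦ x + s ∂₀` (it depends on the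
spatial coordinates only; Visser arXiv:0706.0622, (35)). -/
theorem kerr_radius_add_smul_basisVector_zero (a s : ℝ) (x : E4) :
    Kerr.radius a (x + s • E4.basisVector 0) = Kerr.radius a x :=
  Kerr.radius_eq_of_spatial_eq a (spatial_add_smul_basisVector_zero s x)

/-- **Stationarity of the Kerr–Schild form**: `g_{M,a}(x + s ∂₀) = g_{M,a}(x)` as bilinear forms
on `E4` (Kerr–Schild 1965, §2: `∂_{t*}` is a Killing field of `η + 2Hℓ⊗ℓ`). -/
theorem kerr_bilin_add_smul_basisVector_zero (M a s : ℝ) (x : E4) :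
    Kerr.bilin M a (x + s • E4.basisVector 0) = Kerr.bilin M a x :=
  sub_left_injective (Kerr.ksPert_eq_of_spatial_eq M a (spatial_add_smul_basisVector_zero s x))

/-- `‖x⃗‖² ≤ r² + a²` for the Kerr–Schild radius `r` (from `r² = ((ρ² − a²) + √(…))/2 ≥ ρ² − a²`,
Visser arXiv:0706.0622, (35)). -/
theorem spatialNorm_sq_le_kerr_radius_sq_add (a : ℝ) (x : E4) :
    E4.spatialNorm x ^ 2 ≤ Kerr.radius a x ^ 2 + a ^ 2 := by
  rw [Kerr.radius_sq]
  have h := Kerr.abs_le_sqrt_radius_discr a x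
  have h' := le_abs_self (E4.spatialNorm x ^ 2 - a ^ 2)
  linarith

/-- `‖x⃗‖ ≤ r + |a|`: the Euclidean distance from the axis is at most the Kerr–Schild radius plus
`|a|` (the level sets `{r = const}` are confocal ellipsoids with semi-axes `√(r² + a²)` and `r`). -/
theorem spatialNorm_le_kerr_radius_add_abs (a : ℝ) (x : E4) :
    E4.spatialNorm x ≤ Kerr.radius a x + |a| := by
  have h := spatialNorm_sq_le_kerr_radius_sq_add a x
  have hr := Kerr.radius_nonneg a x
  have ha := abs_nonneg a
  refine le_of_sq_le_sq ?_ (by positivity)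
  nlinarith [sq_abs a]

/-! ## §2 Re-clocked motions `(Λ, c) ↦ (Λ, c + Λ(s ∂₀))` -/

section Reclock

variable (Λ : lorentzGroup) (c : E4) (s : ℝ)

/-- Rest-frame coordinates for the re-clocked motion: `Λ⁻¹(y − c − Λ(s∂₀)) = Λ⁻¹(y − c) − s∂₀`. -/
theorem poincareInv_add_map_smul (y : E4) :
    poincareInv Λ (c + (Λ : E4 ≃L[ℝ] E4) (s • E4.basisVector 0)) y =
      poincareInv Λ c y + (-s) • E4.basisVector 0 := by
  simp only [poincareInv]
  rw [show y - (c + (Λ : E4 ≃L[ℝ] E4) (s • E4.basisVector 0)) =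
      (y - c) - (Λ : E4 ≃L[ℝ] E4) (s • E4.basisVector 0) by abel,
    map_sub, ContinuousLinearEquiv.symm_apply_apply, neg_smul, sub_eq_add_neg]

/-- Re-clocking does not change the boosted Kerr exterior (membership form). -/
theorem mem_boostedKerrExterior_add_map_smul_iff (M a : ℝ) (y : E4) :
    y ∈ boostedKerrExterior Λ (c + (Λ : E4 ≃L[ℝ] E4) (s • E4.basisVector 0)) M a ↔
      y ∈ boostedKerrExterior Λ c M a := by
  simp only [mem_boostedKerrExterior, Kerr.mem_exterior, poincareInv_add_map_smul,
    kerr_radius_add_smul_basisVector_zero]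

/-- Re-clocking does not change the boosted Kerr exterior (as an open set of `E4`). -/
theorem boostedKerrExterior_add_map_smul (M a : ℝ) :
    boostedKerrExterior Λ (c + (Λ : E4 ≃L[ℝ] E4) (s • E4.basisVector 0)) M a =
      boostedKerrExterior Λ c M a :=
  TopologicalSpace.Opens.ext (Set.ext fun y ↦ mem_boostedKerrExterior_add_map_smul_iff Λ c s M a y)

/-- Re-clocking does not change the boosted Kerr–Schild reference form (stationarity, §1). -/
theorem boostedKerrBilin_add_map_smul (M a : ℝ) :
    boostedKerrBilin Λ (c + (Λ : E4 ≃L[ℝ] E4) (s • E4.basisVector 0)) M a =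
      boostedKerrBilin Λ c M a := by
  funext x
  ext v w
  rw [boostedKerrBilin_apply, boostedKerrBilin_apply, poincareInv_add_map_smul,
    kerr_bilin_add_smul_basisVector_zero]

/-- The re-clocked background has the same domain. -/
theorem boostedKerrBackground_add_map_smul_domain (M a : ℝ) :
    (boostedKerrBackground Λ (c + (Λ : E4 ≃L[ℝ] E4) (s • E4.basisVector 0)) M a).domain =
      (boostedKerrBackground Λ c M a).domain :=
  boostedKerrExterior_add_map_smul Λ c s M a

/-- The re-clocked background has the same reference bilinear form. -/
theorem boostedKerrBackground_add_map_smul_bilin (M a : ℝ) :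
    (boostedKerrBackground Λ (c + (Λ : E4 ≃L[ℝ] E4) (s • E4.basisVector 0)) M a).bilin =
      (boostedKerrBackground Λ c M a).bilin :=
  boostedKerrBilin_add_map_smul Λ c s M a

/-- The re-clocked background has the same radius function. -/
theorem boostedKerrBackground_add_map_smul_radius (M a : ℝ) :
    (boostedKerrBackground Λ (c + (Λ : E4 ≃L[ℝ] E4) (s • E4.basisVector 0)) M a).radius =
      (boostedKerrBackground Λ c M a).radius := by
  funext y
  show Kerr.radius a (poincareInv Λ _ y) = Kerr.radius a (poincareInv Λ c y)
  rw [poincareInv_add_map_smul, kerr_radius_add_smul_basisVector_zero]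

/-- The re-clocked background's time function is the old one minus `s` (hole clocks can be set
back by any amount without touching the geometry). -/
theorem boostedKerrBackground_add_map_smul_time (M a : ℝ) (y : E4) :
    (boostedKerrBackground Λ (c + (Λ : E4 ≃L[ℝ] E4) (s • E4.basisVector 0)) M a).time y =
      (boostedKerrBackground Λ c M a).time y - s := by
  show (poincareInv Λ _ y) 0 = (poincareInv Λ c y) 0 - s
  rw [poincareInv_add_map_smul]
  simp [sub_eq_add_neg]

end Reclock

/-! ## §3 The shrunk flat domain is open -/

/-- For continuous tube profiles `ρ'ᵢ` (finitely many holes with spins `aᵢ` and motions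
`(Λᵢ, cᵢ)`), the late tube complement `{y | τ < y⁰ ∧ ∀ i, ρ'ᵢ(y⁰) < rᵢ(Λᵢ⁻¹(y − cᵢ))}` is open in
`E4` (so it is an admissible `flatDomain` of a `FinalStateDecomposition`). -/
theorem isOpen_setOf_lt_tubes {ι : Type*} [Finite ι] (τ : ℝ) (ρ' : ι → ℝ → ℝ)
    (hρ' : ∀ i, Continuous (ρ' i)) (a : ι → ℝ) (Λ : ι → lorentzGroup) (c : ι → E4) :
    IsOpen {y : E4 | τ < y 0 ∧ ∀ i, ρ' i (y 0) < Kerr.radius (a i) (poincareInv (Λ i) (c i) y)} := by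
  have h0 : Continuous fun y : E4 ↦ y 0 := PiLp.continuous_apply 2 _ 0
  simp only [Set.setOf_and, Set.setOf_forall]
  refine (isOpen_lt continuous_const h0).inter (isOpen_iInter_of_finite fun i ↦ ?_)
  exact isOpen_lt ((hρ' i).comp h0)
    ((Kerr.continuous_radius (a i)).comp (continuous_poincareInv (Λ i) (c i)))

/-- The late tube complement is a neighbourhood of each of its points (membership in `𝓝`). -/
theorem setOf_lt_tubes_mem_nhds {ι : Type*} [Finite ι] (τ : ℝ) (ρ' : ι → ℝ → ℝ)
    (hρ' : ∀ i, Continuous (ρ' i)) (a : ι → ℝ) (Λ : ι → lorentzGroup) (c : ι → E4) {y : E4}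
    (hy : τ < y 0 ∧ ∀ i, ρ' i (y 0) < Kerr.radius (a i) (poincareInv (Λ i) (c i) y)) :
    {y : E4 | τ < y 0 ∧ ∀ i, ρ' i (y 0) < Kerr.radius (a i) (poincareInv (Λ i) (c i) y)} ∈ 𝓝 y :=
  (isOpen_setOf_lt_tubes τ ρ' hρ' a Λ c).mem_nhds hy

/-! ## §4 Clock algebra of the Lorentz group -/

section Lorentz

variable (Λ : lorentzGroup)

/-- `Λ⁻¹` preserves `η` as well: `η(Λ⁻¹v, Λ⁻¹w) = η(v, w)` (O'Neill 1983, Ch. 9, p. 233). -/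
theorem minkowski_bilin_symm_symm (v w : E4) :
    Minkowski.bilin ((Λ : E4 ≃L[ℝ] E4).symm v) ((Λ : E4 ≃L[ℝ] E4).symm w) = Minkowski.bilin v w := by
  have h := Λ.2 ((Λ : E4 ≃L[ℝ] E4).symm v) ((Λ : E4 ≃L[ℝ] E4).symm w)
  rw [ContinuousLinearEquiv.apply_symm_apply, ContinuousLinearEquiv.apply_symm_apply] at h
  exact h.symm

/-- **Time component of a Lorentz-transformed vector**: with `u := Λ⁻¹∂₀`,
`(Λx)⁰ = u⁰ x⁰ − Σₖ uᵏ xᵏ` (`(Λx)⁰ = −η(∂₀, Λx) = −η(Λ⁻¹∂₀, x)`). -/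
theorem lorentz_apply_zero (x : E4) :
    ((Λ : E4 ≃L[ℝ] E4) x) 0 =
      ((Λ : E4 ≃L[ℝ] E4).symm (E4.basisVector 0)) 0 * x 0 -
        ∑ k : Fin 3, ((Λ : E4 ≃L[ℝ] E4).symm (E4.basisVector 0)) k.succ * x k.succ := by
  have h := Λ.2 ((Λ : E4 ≃L[ℝ] E4).symm (E4.basisVector 0)) x
  rw [ContinuousLinearEquiv.apply_symm_apply, Minkowski.bilin_basisVector_zero_left,
    Minkowski.bilin_apply] at h
  linarith

/-- `(Λ⁻¹∂₀)⁰ = (Λ∂₀)⁰` (`= Λ⁰₀`; for Lorentz matrices `Λ⁻¹ = ηΛᵀη`). -/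
theorem lorentz_symm_basisVector_zero_apply_zero :
    ((Λ : E4 ≃L[ℝ] E4).symm (E4.basisVector 0)) 0 = ((Λ : E4 ≃L[ℝ] E4) (E4.basisVector 0)) 0 := by
  have h := lorentz_apply_zero Λ (E4.basisVector 0)
  simp [Fin.succ_ne_zero] at h
  exact h.symm

/-- `γ² = 1 + Σₖ ((Λ∂₀)ᵏ)²` for `γ := (Λ∂₀)⁰` (`η(Λ∂₀, Λ∂₀) = −1`). -/
theorem lorentz_time_sq :
    (((Λ : E4 ≃L[ℝ] E4) (E4.basisVector 0)) 0) ^ 2 =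
      1 + ∑ k : Fin 3, (((Λ : E4 ≃L[ℝ] E4) (E4.basisVector 0)) k.succ) ^ 2 := by
  have h := Λ.2 (E4.basisVector 0) (E4.basisVector 0)
  rw [Minkowski.bilin_basisVector_zero, Minkowski.bilin_apply] at h
  simp only [pow_two]
  linarith

/-- `(u⁰)² = 1 + Σₖ (uᵏ)²` for `u := Λ⁻¹∂₀` (`η(Λ⁻¹∂₀, Λ⁻¹∂₀) = −1`). -/
theorem lorentz_symm_time_sq :
    (((Λ : E4 ≃L[ℝ] E4).symm (E4.basisVector 0)) 0) ^ 2 =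
      1 + ∑ k : Fin 3, (((Λ : E4 ≃L[ℝ] E4).symm (E4.basisVector 0)) k.succ) ^ 2 := by
  have h := minkowski_bilin_symm_symm Λ (E4.basisVector 0) (E4.basisVector 0)
  rw [Minkowski.bilin_basisVector_zero, Minkowski.bilin_apply] at h
  simp only [pow_two]
  linarith

/-- `1 ≤ γ²` for `γ := (Λ∂₀)⁰`, every `Λ ∈ O(1,3)`. -/
theorem one_le_lorentz_time_sq : 1 ≤ (((Λ : E4 ≃L[ℝ] E4) (E4.basisVector 0)) 0) ^ 2 := by
  rw [lorentz_time_sq]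
  have := Finset.sum_nonneg fun (k : Fin 3) (_ : k ∈ Finset.univ) ↦
    sq_nonneg (((Λ : E4 ≃L[ℝ] E4) (E4.basisVector 0)) k.succ)
  linarith

/-- For an ORTHOCHRONOUS `Λ` (`(Λ∂₀)⁰ > 0`, clause (1) of `HonestCore`): `γ = (Λ∂₀)⁰ ≥ 1`. -/
theorem one_le_lorentz_time (h : 0 < ((Λ : E4 ≃L[ℝ] E4) (E4.basisVector 0)) 0) :
    1 ≤ ((Λ : E4 ≃L[ℝ] E4) (E4.basisVector 0)) 0 := by
  nlinarith [one_le_lorentz_time_sq Λ]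

/-- **Boost bound on the time component**: `|(Λx)⁰ − γ x⁰| ≤ √(γ² − 1) ‖x⃗‖` with `γ := (Λ∂₀)⁰`
(Cauchy–Schwarz on `Σₖ uᵏxᵏ`, `Σₖ (uᵏ)² = γ² − 1`). -/
theorem abs_lorentz_apply_zero_sub_le (x : E4) :
    |((Λ : E4 ≃L[ℝ] E4) x) 0 - ((Λ : E4 ≃L[ℝ] E4) (E4.basisVector 0)) 0 * x 0| ≤
      Real.sqrt ((((Λ : E4 ≃L[ℝ] E4) (E4.basisVector 0)) 0) ^ 2 - 1) * E4.spatialNorm x := by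
  set u : E4 := (Λ : E4 ≃L[ℝ] E4).symm (E4.basisVector 0) with hu
  have hγ : ((Λ : E4 ≃L[ℝ] E4) (E4.basisVector 0)) 0 = u 0 :=
    (lorentz_symm_basisVector_zero_apply_zero Λ).symm
  have h0 := lorentz_apply_zero Λ x
  rw [← hu] at h0
  have hsum : ((Λ : E4 ≃L[ℝ] E4) x) 0 - u 0 * x 0 = -∑ k : Fin 3, u k.succ * x k.succ := by
    linarith
  have hus : ∑ k : Fin 3, u k.succ ^ 2 = u 0 ^ 2 - 1 := by
    have := lorentz_symm_time_sq Λ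
    rw [← hu] at this
    linarith
  have hxs : ∑ k : Fin 3, x k.succ ^ 2 = E4.spatialNorm x ^ 2 := by
    rw [E4.spatialNorm_sq, Fin.sum_univ_three]
    rfl
  have hcs := Finset.sum_mul_sq_le_sq_mul_sq Finset.univ (fun k : Fin 3 ↦ u k.succ)
    (fun k ↦ x k.succ)
  rw [hus, hxs] at hcs
  rw [hγ, hsum, abs_neg]
  have hnn : 0 ≤ u 0 ^ 2 - 1 := by
    rw [← hus]
    exact Finset.sum_nonneg fun k _ ↦ sq_nonneg _
  calc |∑ k : Fin 3, u k.succ * x k.succ|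
      ≤ Real.sqrt ((u 0 ^ 2 - 1) * E4.spatialNorm x ^ 2) := Real.abs_le_sqrt hcs
    _ = Real.sqrt (u 0 ^ 2 - 1) * E4.spatialNorm x := by
        rw [Real.sqrt_mul hnn, Real.sqrt_sq (E4.spatialNorm_nonneg x)]

/-- A point of `E4` in terms of its rest-frame coordinates: `y = c + Λ(Λ⁻¹(y − c))`. -/
theorem eq_add_lorentz_poincareInv (c y : E4) :
    y = c + (Λ : E4 ≃L[ℝ] E4) (poincareInv Λ c y) := by
  rw [poincareInv, ContinuousLinearEquiv.apply_symm_apply, add_sub_cancel]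

/-- **Flat time versus hole time on a boosted Kerr background**: for the motion `(Λ, c)`,
`|y⁰ − c⁰ − γ·t(y)| ≤ √(γ² − 1)·(r(y) + |a|)`, where `t, r` are the rest-frame Kerr–Schild time and
radius of `boostedKerrBackground Λ c M a` and `γ = (Λ∂₀)⁰`.  With `γ ≥ 1` (orthochronous) this is
the source of the clock lag S9 (after shifting `c ↦ c + Λ(s∂₀)`) and of "flat-late on a sublinear
tube ⇒ hole time as late as required". -/
theorem abs_flatTime_sub_le (c : E4) (M a : ℝ) (y : E4) :
    |y 0 - c 0 - ((Λ : E4 ≃L[ℝ] E4) (E4.basisVector 0)) 0 *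
        (boostedKerrBackground Λ c M a).time y| ≤
      Real.sqrt ((((Λ : E4 ≃L[ℝ] E4) (E4.basisVector 0)) 0) ^ 2 - 1) *
        ((boostedKerrBackground Λ c M a).radius y + |a|) := by
  set x : E4 := poincareInv Λ c y with hx
  have hy : y 0 - c 0 = ((Λ : E4 ≃L[ℝ] E4) x) 0 := by
    have h := congrArg (fun v : E4 ↦ v 0) (eq_add_lorentz_poincareInv Λ c y)
    simp only [PiLp.add_apply] at h
    rw [← hx] at h
    linarith
  show |y 0 - c 0 - _ * x 0| ≤ _ * (Kerr.radius a x + |a|)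
  rw [hy]
  refine (abs_lorentz_apply_zero_sub_le Λ x).trans ?_
  exact mul_le_mul_of_nonneg_left (spatialNorm_le_kerr_radius_add_abs a x) (Real.sqrt_nonneg _)

end Lorentz

/-- Registered helper sub-goal `stub_seamSurgery_clockComparison` of the seam stub N2 (statement =
`abs_flatTime_sub_le`, closed form): on the boosted Kerr background of a motion `(Λ, c)` with spin
`a`, `|y⁰ − c⁰ − γ·t(y)| ≤ √(γ² − 1)·(r(y) + |a|)`, `γ = (Λ∂₀)⁰` — the flat-time / hole-time
comparison behind the clock lag S9 of `Seamed` and the "flat-late on a tube ⇒ hole-late" step. -/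
theorem stub_seamSurgery_clockComparison :
  ∀ (Λ : lorentzGroup) (c : E4) (M a : ℝ) (y : E4), |y 0 - c 0 - ((Λ : E4 ≃L[ℝ] E4) (E4.basisVector 0)) 0 * (boostedKerrBackground Λ c M a).time y| ≤ Real.sqrt ((((Λ : E4 ≃L[ℝ] E4) (E4.basisVector 0)) 0) ^ 2 - 1) * ((boostedKerrBackground Λ c M a).radius y + |a|) :=
  abs_flatTime_sub_le

end Summit.FinalStateConjecture.FinalStateConjecture.Theorems.NecksCertifyBargmann.Seam

end
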